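import Literature.AlgebraicGeometry.Resolution.BlowupChartQuasiRegular
import Literature.AlgebraicGeometry.Motives.VarietiesProjectiveSpaceProofs
import Mathlib.RingTheory.GradedAlgebra.Homogeneous.Maps
import HarnessLib

/-!
# The Rees algebra of `(x₀, …, x_r)` as a quotient of `L[T₀, …, T_r]`, and the exceptional charts

Topic: `Literature/AlgebraicGeometry/Resolution`. Theorem-only file (sorry-free). For elements
`x₀, …, x_r` of a commutative ring `L`, `I = (x)`, the Rees algebra `L[It]` (`AffineBlowup.lean`,
graded by `reesGrading I`) is a graded quotient of the polynomial ring `L[T₀, …, T_r]` (graded by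
total degree): `T_j ↦ x_j t` (`reesPresentation x : L[T] →+*ᵍ L[It]`, surjective, and the
irrelevant ideal of `L[It]` is generated by the image of that of `L[T]` — the hypothesis of
Mathlib's functoriality `Proj.map`, which therefore yields the closed immersion
`Bl_I(Spec L) = Proj L[It] ↪ Proj L[T] = ℙʳ_L`). On the standard chart `T_i ≠ 0` the induced map
of degree-zero localisations `(L[T]_{T_i})₀ → (L[It]_{(x_i t)})₀` (Mathlib `Away.map`), followed by
reduction modulo the exceptional ideal `I · (L[It]_{(x_i t)})₀ = (x_i)`, has kernel EXACTLY
`I · (L[T]_{T_i})₀` when `x` is **quasi-regular** (`ker_quotient_comp_awayMap_reesPresentation`):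
this is the chart algebra `(L[It])_{(x_i t)} ⧸ (x_i) ≅ (L ⧸ I)[T_j : j ≠ i]` of
`BlowupChartQuasiRegular.lean`, read through the dehomogenisation isomorphism
`(L[T]_{T_i})₀ ≅ L[y₁, …, y_r]` of `Motives/VarietiesProjectiveSpaceProofs`. Geometrically: over the
chart `D₊(T_i)` of `ℙʳ_L`, the exceptional divisor `E = Bl ×_{Spec L} V(I)` is the closed
subscheme `V(I) × D₊(T_i)` — the chartwise content of Hartshorne II Thm. 8.24 (b) / Liu
Thm. 8.1.19 (b) (`E ≅ ℙ(𝓘/𝓘²) ≅ V(I) × ℙʳ` locally), assembled into the global statement in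
`ExceptionalDivisorProjectiveBundle.lean`.

* `reesPresentation x`, `reesPresentation_X`, `reesPresentation_surjective`,
  `irrelevant_le_map_reesPresentation`;
* `reesAwayBase x s : L → (L[It]_s)₀` (`= reesChartBase b` for `s = bt`, `rfl`);
* `awayMap_reesPresentation_algebraMap` — `Away.map` is `L`-linear;
* `quotient_comp_awayMap_reesPresentation_surjective`,
  `ker_quotient_comp_awayMap_reesPresentation` — **the exceptional chart is `V(I) × 𝔸ʳ`**.

## References

* R. Hartshorne, *Algebraic Geometry*, GTM 52 (1977), II Thm. 8.24 (b), II Ex. 3.12 (a).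
  [Hartshorne1977]
* Q. Liu, *Algebraic Geometry and Arithmetic Curves* (2002), Thm. 8.1.19 (b). [Liu2002]
* The Stacks Project, Tag 0BIQ (blow-up algebra of a regular sequence). [StacksProject]
-/

noncomputable section

open HomogeneousLocalization MvPolynomial

namespace Literature.AlgebraicGeometry.Resolution

universe u

attribute [local instance] MvPolynomial.gradedAlgebra
  Literature.AlgebraicGeometry.Motives.ProjBaseChange.algebraBase

variable {L : Type u} [CommRing L] {r : ℕ} (x : Fin (r + 1) → L)

local notation3 "𝓘" => Ideal.span (Set.range x)
local notation3 "ℛ" => reesGrading (Ideal.span (Set.range x))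
local notation3 "𝒜" => MvPolynomial.homogeneousSubmodule (Fin (r + 1)) L

/-! ## The graded presentation `L[T₀, …, T_r] → L[It]`, `T_j ↦ x_j t` -/

/-- The `L`-algebra map `L[T₀, …, T_r] → L[It]`, `T_j ↦ x_j t`. [folklore] -/
def reesPresentationₐ : MvPolynomial (Fin (r + 1)) L →ₐ[L] reesAlgebra 𝓘 :=
  aeval fun j => reesT (x j) (Ideal.mem_span_range_self (f := x) (x := j))

/-- `reesPresentationₐ` on a variable (unfolding). [folklore] -/
@[simp]
theorem reesPresentationₐ_X (j : Fin (r + 1)) :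
    reesPresentationₐ x (X j) = reesT (x j) (Ideal.mem_span_range_self (f := x) (x := j)) :=
  aeval_X _ j

/-- The underlying polynomial of `reesPresentationₐ x P` is `P(x₀ t, …, x_r t)`. [folklore] -/
theorem coe_reesPresentationₐ (P : MvPolynomial (Fin (r + 1)) L) :
    ((reesPresentationₐ x P : reesAlgebra 𝓘) : Polynomial L) =
      aeval (fun j => Polynomial.X * Polynomial.C (x j)) P := by
  have h : ((reesAlgebra 𝓘).val.comp (reesPresentationₐ x) : MvPolynomial (Fin (r + 1)) L →ₐ[L] _) =
      aeval fun j => Polynomial.X * Polynomial.C (x j) := by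
    refine MvPolynomial.algHom_ext fun j => ?_
    rw [AlgHom.comp_apply, reesPresentationₐ_X, aeval_X, Subalgebra.coe_val, coe_reesT,
      Polynomial.X_mul_C, ← Polynomial.C_mul_X_eq_monomial]
  exact congr($h P)

/-- A form of degree `n` goes to `P(x) tⁿ`: the presentation is graded. [folklore] -/
theorem coe_reesPresentationₐ_of_isHomogeneous {P : MvPolynomial (Fin (r + 1)) L} {n : ℕ}
    (hP : P.IsHomogeneous n) :
    ((reesPresentationₐ x P : reesAlgebra 𝓘) : Polynomial L) =
      Polynomial.monomial n (MvPolynomial.eval x P) := by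
  rw [coe_reesPresentationₐ, Motives.ProjectiveSpace.isHomogeneous_aeval_const_mul hP]
  have : aeval (fun j => Polynomial.C (x j)) P = Polynomial.C (MvPolynomial.eval x P) := by
    rw [MvPolynomial.aeval_def, Polynomial.algebraMap_eq]
    change _ = Polynomial.C (MvPolynomial.eval₂ (RingHom.id L) x P)
    rw [MvPolynomial.eval₂_comp_left, RingHom.comp_id]
    rfl
  rw [this, ← Polynomial.C_mul_X_pow_eq_monomial, mul_comm]

/-- **The graded presentation `L[T₀, …, T_r] →ᵍ L[It]`, `T_j ↦ x_j t`** (graded for the total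
degree on `L[T]` and the Rees grading `Iⁿtⁿ`). [folklore] -/
def reesPresentation : 𝒜 →+*ᵍ ℛ where
  __ := (reesPresentationₐ x).toRingHom
  map_mem := fun {_} {P} hP => ⟨MvPolynomial.eval x P, (coe_reesPresentationₐ_of_isHomogeneous x hP).symm⟩

/-- `reesPresentation` is `reesPresentationₐ` on elements (`rfl`). [folklore] -/
theorem reesPresentation_apply (P : MvPolynomial (Fin (r + 1)) L) :
    reesPresentation x P = reesPresentationₐ x P := rfl

/-- `reesPresentation x (T_j) = x_j t`. [folklore] -/
@[simp]
theorem reesPresentation_X (j : Fin (r + 1)) :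
    reesPresentation x (X j) = reesT (x j) (Ideal.mem_span_range_self (f := x) (x := j)) :=
  reesPresentationₐ_X x j

/-- `reesPresentation` is `L`-linear. [folklore] -/
theorem reesPresentation_algebraMap (a : L) :
    reesPresentation x (algebraMap L (MvPolynomial (Fin (r + 1)) L) a) =
      algebraMap L (reesAlgebra 𝓘) a :=
  (reesPresentationₐ x).commutes a

/-- Every `b t`, `b ∈ I`, is an `L`-linear combination of the `x_j t`. [folklore] -/
theorem reesT_mem_span_range (b : L) (hb : b ∈ 𝓘) :
    reesT b hb ∈ Submodule.span L (Set.range fun j : Fin (r + 1) =>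
      reesT  (x j) (Ideal.mem_span_range_self (f := x) (x := j))) := by
  obtain ⟨c, hc⟩ := Ideal.mem_span_range_iff_exists_fun.mp hb
  have : reesT b hb = ∑ j, c j • reesT  (x j) (Ideal.mem_span_range_self (f := x) (x := j)) := by
    apply Subtype.ext
    rw [coe_reesT, ← hc, map_sum, AddSubmonoidClass.coe_finsetSum]
    refine Finset.sum_congr rfl fun j _ => ?_
    rw [Subalgebra.coe_smul, coe_reesT, Polynomial.smul_monomial, smul_eq_mul]
  rw [this]
  exact Submodule.sum_mem _ fun j _ => Submodule.smul_mem _ _ (Submodule.subset_span ⟨j, rfl⟩)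

/-- **The presentation is surjective**: `L[It]` is generated by the `b t`, `b ∈ I`
(`adjoin_range_reesT_eq_top`), which are combinations of the `x_j t`. [folklore] -/
theorem reesPresentation_surjective : Function.Surjective (reesPresentation x) := by
  intro z
  have hz : z ∈ (reesPresentationₐ x).range := by
    rw [reesPresentationₐ, ← Algebra.adjoin_range_eq_range_aeval]
    have hle : Algebra.adjoin L (Set.range fun b : 𝓘 => reesT  b.1 b.2) ≤
        Algebra.adjoin L (Set.range fun j : Fin (r + 1) =>
          reesT  (x j) (Ideal.mem_span_range_self (f := x) (x := j))) := by
      refine Algebra.adjoin_le ?_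
      rintro _ ⟨b, rfl⟩
      exact Algebra.span_le_adjoin L _ (reesT_mem_span_range x b.1 b.2)
    exact hle (by rw [adjoin_range_reesT_eq_top]; trivial)
  obtain ⟨P, hP⟩ := hz
  exact ⟨P, hP⟩

/-- The irrelevant ideal of `L[It]` is generated by the image of that of `L[T]` (the hypothesis of
Mathlib's `Proj.map`): `L[It]₊` is generated by the `b t` (`irrelevant_le_span_reesT`), and
`x_j t` is the image of the positive-degree element `T_j`. [folklore] -/
theorem irrelevant_le_map_reesPresentation :
    HomogeneousIdeal.irrelevant ℛ ≤ (HomogeneousIdeal.irrelevant 𝒜).map (reesPresentation x) := by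
  rw [← toIdeal_le_toIdeal_iff, HomogeneousIdeal.toIdeal_map]
  refine (irrelevant_le_span_reesT 𝓘).trans (Ideal.span_le.mpr ?_)
  rintro _ ⟨b, rfl⟩
  have hmem : ∀ j : Fin (r + 1), reesT  (x j) (Ideal.mem_span_range_self (f := x) (x := j)) ∈
      ((HomogeneousIdeal.irrelevant 𝒜).toIdeal).map (reesPresentation x) := fun j => by
    rw [← reesPresentation_X x j]
    exact Ideal.mem_map_of_mem _ (HomogeneousIdeal.mem_irrelevant_of_mem _ one_pos
      (Motives.ProjectiveSpace.X_mem (R := L) j))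
  have := reesT_mem_span_range x b.1 b.2
  rw [Submodule.mem_span_range_iff_exists_fun] at this
  obtain ⟨c, hc⟩ := this
  change reesT b.1 b.2 ∈ _
  rw [← hc]
  exact Ideal.sum_mem _ fun j _ => by
    rw [Algebra.smul_def]
    exact Ideal.mul_mem_left _ _ (hmem j)

/-! ## The structure maps `L → (L[It]_s)₀` of the chart rings -/

/-- The structure map `L → (L[It]_s)₀`, `a ↦ a/1`, of the degree-zero localisation of the Rees
algebra at a homogeneous `s` (Mathlib `fromZeroRingHom` after `L ≅ (L[It])₀`); for `s = bt` this
is `reesChartBase b` of `AffineBlowup.lean`, by `rfl`. [folklore] -/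
def reesAwayBase (s : reesAlgebra 𝓘) : L →+* Away ℛ s :=
  (fromZeroRingHom ℛ (Submonoid.powers s)).comp (reesGrading.zeroRingHom 𝓘)

/-- `reesAwayBase (bt) = reesChartBase b` (`rfl`). [folklore] -/
theorem reesAwayBase_reesT (b : L) (hb : b ∈ 𝓘) :
    reesAwayBase x (reesT b hb) = reesChartBase b hb := rfl

/-- The value of `a/1`. [folklore] -/
theorem val_reesAwayBase (s : reesAlgebra 𝓘) (a : L) :
    (reesAwayBase x s a).val = Localization.mk (algebraMap L (reesAlgebra 𝓘) a) 1 := rfl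

/-- `Away.map` of the presentation is `L`-linear: `a/1 ↦ a/1`. [folklore] -/
theorem awayMap_reesPresentation_algebraMap (s : MvPolynomial (Fin (r + 1)) L) (a : L) :
    Away.map (reesPresentation x) s (algebraMap L (Away 𝒜 s) a) =
      reesAwayBase x (reesPresentation x s) a := by
  refine val_injective _ ?_
  rw [Motives.ProjBaseChange.algebraMap_eq', Away.map, HomogeneousLocalization.map_mk, val_mk,
    val_reesAwayBase]
  refine congrArg₂ Localization.mk ?_ (Subtype.ext ?_)
  · change reesPresentation x (algebraMap L (MvPolynomial (Fin (r + 1)) L) a) = algebraMap L (reesAlgebra 𝓘) a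
    exact reesPresentation_algebraMap x a
  · change reesPresentation x 1 = 1
    exact map_one _

/-! ## The exceptional chart: kernel of `(L[T]_{T_i})₀ → (L[It]_{(x_i t)})₀ ⧸ (x_i)` -/

section Chart

variable (i : Fin (r + 1))

/-- `x_i t` is the image of `T_i`, as a membership-transport helper: `reesPresentation x (T_i)`
has degree one. [folklore] -/
theorem reesPresentation_X_mem : reesPresentation x (X i) ∈ ℛ 1 :=
  (reesPresentation x).map_mem (Motives.ProjectiveSpace.X_mem (R := L) i)

/-- `x_j t` has degree `1 = 1 • 1` (for `Away.mk`). [folklore] -/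
theorem reesT_mem_one_smul' (j : Fin (r + 1)) :
    reesT  (x j) (Ideal.mem_span_range_self (f := x) (x := j)) ∈ ℛ (1 • 1) := by
  rw [one_smul]; exact reesT_mem _ _

/-- The kernel computation of `BlowupChartQuasiRegular.lean`, re-indexed by `Fin r` through
`Fin.succAbove i` and stated for any chart element `s` equal to `x_i t`: if `x` is quasi-regular
and the polynomial `P ∈ L[y₁, …, y_r]` evaluates, at `y_j ↦ (x_{i.succAbove j} t)/s` over
`a ↦ a/1`, into the ideal `(x_i/1)`, then all coefficients of `P` lie in `I`.
[cite: StacksProject, Tag 0BIQ] -/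
theorem mem_map_C_of_eval₂_mem_span (hx : IsQuasiRegular x) {s : reesAlgebra 𝓘} (hs1 : s ∈ ℛ 1)
    (hs : s = reesT (x i) (Ideal.mem_span_range_self (f := x) (x := i)))
    (P : MvPolynomial (Fin r) L)
    (hP : MvPolynomial.eval₂Hom ((fromZeroRingHom ℛ (Submonoid.powers s)).comp (reesGrading.zeroRingHom 𝓘))
        (fun j => Away.mk ℛ hs1 1 (reesT (x (i.succAbove j))
          (Ideal.mem_span_range_self (f := x) (x := i.succAbove j))) (reesT_mem_one_smul' x _)) P ∈
      Ideal.span {((fromZeroRingHom ℛ (Submonoid.powers s)).comp (reesGrading.zeroRingHom 𝓘)) (x i)}) :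
    P ∈ Ideal.map (C : L →+* MvPolynomial (Fin r) L) 𝓘 := by
  subst hs
  classical
  set σ := finSuccAboveEquiv i with hσ
  have key := ker_quotient_comp_eval₂Hom_eq x i hx
  have hren : MvPolynomial.rename σ P ∈ RingHom.ker ((Ideal.Quotient.mk
      (Ideal.span {reesChartBase (x i) (Ideal.mem_span_range_self (f := x) (x := i)) (x i)})).comp
      (MvPolynomial.eval₂Hom (reesChartBase (x i) (Ideal.mem_span_range_self (f := x) (x := i)))
        (fun j : {j : Fin (r + 1) // j ≠ i} => Away.mk ℛ
          (reesT_mem (x i) (Ideal.mem_span_range_self (f := x) (x := i))) 1 (reesT (x j.1)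
            (Ideal.mem_span_range_self (f := x) (x := j.1))) (reesT_mem_one_smul x j.1)))) := by
    rw [RingHom.mem_ker, RingHom.comp_apply, Ideal.Quotient.eq_zero_iff_mem, MvPolynomial.coe_eval₂Hom,
      MvPolynomial.eval₂_rename]
    exact hP
  rw [key] at hren
  rw [MvPolynomial.mem_map_C_iff] at hren ⊢
  intro m
  have := hren (m.mapDomain σ)
  rwa [MvPolynomial.coeff_rename_mapDomain σ σ.injective] at this

/-- On the chart of `x_i t`, `I` becomes principal, generated by `x_i/1` — for any chart element
`s` equal to `x_i t` (`span_image_reesChartBase_eq`). [cite: StacksProject, Tag 0804] -/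
theorem map_reesAwayBase_eq_span {s : reesAlgebra 𝓘}
    (hs : s = reesT (x i) (Ideal.mem_span_range_self (f := x) (x := i))) :
    Ideal.map (reesAwayBase x s) 𝓘 = Ideal.span {reesAwayBase x s (x i)} := by
  subst hs
  exact span_image_reesChartBase_eq (x i) _

/-- `Away.map` of the presentation on the chart generator `T_{i.succAbove j}/T_i` is
`(x_{i.succAbove j} t)/(x_i t)`. [folklore] -/
theorem awayMap_reesPresentation_chartGen (j : Fin r) :
    Away.map (reesPresentation x) (X i) (Motives.ProjectiveSpace.chartGen L i j) =
      Away.mk ℛ (reesPresentation_X_mem x i) 1 (reesT (x (i.succAbove j))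
        (Ideal.mem_span_range_self (f := x) (x := i.succAbove j))) (reesT_mem_one_smul' x _) := by
  rw [Motives.ProjectiveSpace.chartGen, Away.map_mk]
  refine val_injective _ ?_
  rw [Away.val_mk, Away.val_mk]
  exact congrArg₂ Localization.mk (reesPresentation_X x _) rfl

/-- **`Away.map` of the presentation, read on `L[y₁, …, y_r] ≅ (L[T]_{T_i})₀`, is evaluation at
`y_j ↦ (x_{i.succAbove j} t)/(x_i t)` over `a ↦ a/1`.** [folklore] -/
theorem awayMap_reesPresentation_comp_chartAlgEquiv_symm :
    (Away.map (reesPresentation x) (X i)).comp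
        (Motives.ProjectiveSpace.chartAlgEquiv L i).symm.toAlgHom.toRingHom =
      MvPolynomial.eval₂Hom (reesAwayBase x (reesPresentation x (X i)))
        (fun j => Away.mk ℛ (reesPresentation_X_mem x i) 1 (reesT (x (i.succAbove j))
          (Ideal.mem_span_range_self (f := x) (x := i.succAbove j))) (reesT_mem_one_smul' x _)) := by
  refine MvPolynomial.ringHom_ext (fun a => ?_) (fun j => ?_)
  · rw [RingHom.comp_apply, MvPolynomial.coe_eval₂Hom, MvPolynomial.eval₂_C]
    change Away.map (reesPresentation x) (X i) ((Motives.ProjectiveSpace.chartAlgEquiv L i).symm (C a)) = _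
    rw [← MvPolynomial.algebraMap_eq, AlgEquiv.commutes, awayMap_reesPresentation_algebraMap]
  · rw [RingHom.comp_apply, MvPolynomial.coe_eval₂Hom, MvPolynomial.eval₂_X]
    change Away.map (reesPresentation x) (X i) ((Motives.ProjectiveSpace.chartAlgEquiv L i).symm (X j)) = _
    rw [Motives.ProjectiveSpace.chartAlgEquiv_symm_X, awayMap_reesPresentation_chartGen]

/-- For a surjective graded ring homomorphism and a homogeneous `s` of the source, the induced
map of degree-zero localizations `Away.map` is surjective (a homogeneous element of degree
`n · deg s` is the image of the corresponding component of any preimage).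
-- adapted from `Literature.AlgebraicGeometry.FundamentalGroup.away_map_surjective`
[folklore] -/
theorem away_map_surjective_of_surjective {A B σ τ : Type*} [CommRing A] [SetLike σ A]
    [AddSubgroupClass σ A] [CommRing B] [SetLike τ B] [AddSubgroupClass τ B]
    {𝒜' : ℕ → σ} {ℬ : ℕ → τ} [GradedRing 𝒜'] [GradedRing ℬ] (f : 𝒜' →+*ᵍ ℬ)
    (hsurj : Function.Surjective f) {d : ℕ} {s : A} (hs : s ∈ 𝒜' d) :
    Function.Surjective (Away.map f s) := by
  classical
  intro y
  obtain ⟨n, b, hb, rfl⟩ := Away.mk_surjective ℬ (f.2 hs) y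
  obtain ⟨a, ha⟩ := hsurj b
  refine ⟨Away.mk 𝒜' hs n (DirectSum.decompose 𝒜' a (n • d)) (SetLike.coe_mem _), ?_⟩
  rw [Away.map_mk]
  apply val_injective
  simp only [Away.val_mk]
  congr 1
  rw [GradedRingHom.map_directSumDecompose, ha, DirectSum.decompose_of_mem_same ℬ hb]

/-- The exceptional chart map `(L[T]_{T_i})₀ → (L[It]_{(x_i t)})₀ ⧸ I` is surjective.
[folklore] -/
theorem quotient_comp_awayMap_reesPresentation_surjective :
    Function.Surjective ((Ideal.Quotient.mk
        (Ideal.map (reesAwayBase x (reesPresentation x (X i))) 𝓘)).comp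
      (Away.map (reesPresentation x) (X i))) :=
  Ideal.Quotient.mk_surjective.comp
    (away_map_surjective_of_surjective (reesPresentation x) (reesPresentation_surjective x)
      (Motives.ProjectiveSpace.X_mem (R := L) i))

/-- **The exceptional chart over `D₊(T_i)` is `V(I) × 𝔸ʳ`.** For a quasi-regular sequence
`x = (x₀, …, x_r)` in `L`, `I = (x)`, the kernel of
`(L[T₀,…,T_r]_{T_i})₀ → (L[It]_{(x_i t)})₀ → (L[It]_{(x_i t)})₀ ⧸ I·(L[It]_{(x_i t)})₀`
(Mathlib `Away.map` of the presentation `T_j ↦ x_j t`, then reduction modulo the exceptional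
ideal) is exactly `I · (L[T]_{T_i})₀`: under `(L[T]_{T_i})₀ ≅ L[y₁,…,y_r]` this is
`(L[It])_{(x_i t)} ⧸ (x_i) ≅ (L ⧸ I)[y₁,…,y_r]` (Stacks 0BIQ modulo `x_i`; Hartshorne II 8.24 (b),
Liu 8.1.19 (b): the exceptional divisor is `ℙ(𝓘/𝓘²)`, chartwise an affine space over the centre).
[cite: StacksProject, Tag 0BIQ] [cite: Liu2002, Thm. 8.1.19 (b)] -/
theorem ker_quotient_comp_awayMap_reesPresentation (hx : IsQuasiRegular x) :
    RingHom.ker ((Ideal.Quotient.mk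
        (Ideal.map (reesAwayBase x (reesPresentation x (X i))) 𝓘)).comp
      (Away.map (reesPresentation x) (X i))) =
      Ideal.map (algebraMap L (Away 𝒜 (X i))) 𝓘 := by
  apply le_antisymm
  · intro z hz
    rw [RingHom.mem_ker, RingHom.comp_apply, Ideal.Quotient.eq_zero_iff_mem,
      map_reesAwayBase_eq_span x i (reesPresentation_X x i)] at hz
    set θ := Motives.ProjectiveSpace.chartAlgEquiv L i with hθ
    obtain ⟨P, rfl⟩ : ∃ P, θ.symm P = z := ⟨θ z, θ.symm_apply_apply z⟩
    have hev : Away.map (reesPresentation x) (X i) (θ.symm P) =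
        MvPolynomial.eval₂Hom (reesAwayBase x (reesPresentation x (X i)))
          (fun j => Away.mk ℛ (reesPresentation_X_mem x i) 1 (reesT (x (i.succAbove j))
            (Ideal.mem_span_range_self (f := x) (x := i.succAbove j))) (reesT_mem_one_smul' x _)) P :=
      congr($(awayMap_reesPresentation_comp_chartAlgEquiv_symm x i) P)
    rw [hev] at hz
    have hP := mem_map_C_of_eval₂_mem_span x i hx (reesPresentation_X_mem x i)
      (reesPresentation_X x i) P hz
    -- `θ.symm` maps `I · L[y]` into `I · (L[T]_{T_i})₀`
    have : (Ideal.map (C : L →+* MvPolynomial (Fin r) L) 𝓘).map θ.symm.toAlgHom.toRingHom =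
        Ideal.map (algebraMap L (Away 𝒜 (X i))) 𝓘 := by
      rw [Ideal.map_map]
      congr 1
      refine RingHom.ext fun a => ?_
      change θ.symm (C a) = _
      rw [← MvPolynomial.algebraMap_eq, AlgEquiv.commutes]
    rw [← this]
    exact Ideal.mem_map_of_mem _ hP
  · rw [Ideal.map_le_iff_le_comap]
    intro a ha
    rw [Ideal.mem_comap, RingHom.mem_ker, RingHom.comp_apply, awayMap_reesPresentation_algebraMap,
      Ideal.Quotient.eq_zero_iff_mem]
    exact Ideal.mem_map_of_mem _ ha

end Chart

end Literature.AlgebraicGeometry.Resolution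

end
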